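import Literature.Barriers.CriticalPhenomena.WeaklySAWPerturbativeBetaValue
import Literature.MathematicalPhysics.QuantumFieldTheory.Balaban1983to89.Beta.OneShotTelescope
import HarnessLib

/-!
# The ONE-SHOT form of the BBS perturbative coefficients: `Σ_{j<k} β_j(L) = B(L^k)` with `B(N) = 8Σ_x W_N(x)²`
# a functional of the TOTAL blocking factor `N` alone, and the one-shot window law `|B(N) − (log N)/π²| ≤ A` (all real `N ≥ 2`)

Third file of the sequence `WeaklySAWPerturbativeBetaLimit.lean` → `WeaklySAWPerturbativeBetaValue.lean` → (this file) on
the perturbative coefficients `β_j = CTWSAW.betaPT 4 L m² j` of the 4-dimensional weakly self-avoiding walk / `|φ|⁴` model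
for the explicit finite-range decomposition `C_j = LongRangePhi4.FRD.Gam 4 L m² j` of the tree.

Sources.  R. Bauerschmidt, D. C. Brydges, G. Slade, *Logarithmic correction for the susceptibility of the 4-dimensional
weakly self-avoiding walk: a renormalisation group analysis*, Commun. Math. Phys. **337** (2015) 817–877
[BauerschmidtBrydgesSlade2015LogCorr]: §6.1 (`w_j = Σ_{i=1}^j C_i`, `β_j = 8Σ_x(w_{j+1,x}² − w_{j,x}²)`) and Lemma 8.3.1
(proof, first display: `Σ_{j<k}β_j = 8Σ_x w_k(x)²`; tree `CTWSAW.sum_range_betaPT_eq_tsum`).  R. Bauerschmidt,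
D. C. Brydges, G. Slade, *Introduction to a renormalisation group method*, LNM **2242** (2019), arXiv:1907.05474
[BauerschmidtBrydgesSlade2019RG], Ch. 3, "Finite-range decomposition: lattice": «`(-Δ_{ℤ^d}+m²)⁻¹_{0x} = ∫₀^∞ w(t,x) dt/t` …
We decompose the integral into intervals `[0,½L]` and `[½L^{j-1},½L^j]`» — the tree's `Gam d L s 1 = ∫_{(0,L/2]} w(t,·)dt/t`,
`Gam d L s j = ∫_{(L^{j-1}/2, L^j/2]} w(t,·)dt/t` (`j ≥ 2`).  R. Bauerschmidt, D. C. Brydges, G. Slade, *A renormalisation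
group method. III. Perturbative analysis*, J. Stat. Phys. **159** (2015) 492–529 [BauerschmidtBrydgesSlade2015RGIII],
Lemma 6.3 (a) (`lim_j β_j(0) = (log L)/π²`, d = 4; tree `CTWSAW.BBS2015RGIII_lem63a`; the lemma is numbered 6.3 in the
journal/arXiv PDF and appears as «Lemma 6.1.3» (`lem:betalim`, §6.1.3) in the per-subsection counters of the corpus text
`paper:arxiv-1403.7252` p0022 — same statement).

## What this file proves (everything below; no `def … : Prop`, no named fact, no `sorry`)

Because the slices are consecutive pieces of ONE `t`-integral, the accumulated covariance after `k` steps of ratio `L`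
is the integral over `(0, L^k/2]` — a function of the PRODUCT `N = L^k` only:
* `integrableOn_wKer_div_Ioc_of_nonneg` — `t ↦ w(t,x)/t` is integrable on every bounded `(a,b]`, `a ≥ 0`, for EVERY
  mass `s ≥ 0` (uniform bound `FRD.abs_wKer_div_le` + measurability; the tree had this for `s > 0` only).
* `oneShotCov d s N x := ∫_{(0,N/2]} w(t,x)dt/t`, `oneShotBubble d s N := 8Σ'_x (oneShotCov d s N x)²` — the one-shot
  accumulated covariance and bubble at total blocking factor `N` (real).
* **`covSum_eq_oneShotCov`**: `w_k = W_{L^k}` (`k ≥ 1`, `L ≥ 1`, `s ≥ 0`, any `d ≥ 1`);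
  **`sum_range_betaPT_eq_oneShotBubble`**: `Σ_{j<k} β_j(L) = B(L^k)` (`k ≥ 1`);
  `betaPT_zero_eq_oneShotBubble`: `β_0(L) = B(L)`; **`betaPT_eq_oneShotBubble_sub`**: `β_j(L) = B(L^{j+1}) − B(L^j)`
  (`j ≥ 1`); in particular `betaPT_one_eq`: `β_1(L) = B(L²) − B(L)`.
* `covSum_pow_eq` (`w_k(L^m) = w_{mk}(L)`), **`sum_range_betaPT_pow`** (`Σ_{j<k}β_j(L^m) = Σ_{j<mk}β_j(L)`),
  **`betaPT_zero_pow_eq_sum_range`** (`β_0(L^m) = Σ_{j<m}β_j(L)`): `k` steps at ratio `L^m` = `mk` steps at ratio `L`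
  (the BBS form of Gawędzki–Kupiainen's «computing `λ_n` to second order … is equivalent to computing `λ₁` … for `L → L^n`»,
  CMP 99 (1985) p. 208, and of the audit cell's sub-slicing reading (S1) «level `k` of the `L₀^m`-tower = level `mk` of
  the `L₀`-tower»).
* **`abs_oneShotBubble_sub_log_le`** (d = 4, m² = 0): `∃A ∀ real N ≥ 2, |B(N) − (log N)/π²| ≤ A` — the `k = 1` case of
  `CTWSAW.abs_sum_range_betaPT_zero_sub_le`; and conversely `abs_oneShotBubble_pow_sub_le`: the `k`-step statement
  `|B(L^k) − k(log L)/π²| ≤ A` IS the one-shot law at `N = L^k` (`log L^k = k log L`).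
* The ℕ-indexed first-step family `firstStep n` (`= B(n)` for `n ≥ 2`, `0` for `n < 2`) and, for natural `L ≥ 2`:
  `sum_range_betaPT_eq_firstStep` (`Σ_{j<k}β_j(L) = firstStep(L^k)` for ALL `k`, including `k = 0`),
  `abs_firstStep_sub_le` (`|firstStep n − π⁻²·log n| ≤ A`, `n ≥ 2`),
  and — through the AUDIT CELL's own bridge `Beta.OneShotTelescope.oneLoopDrift_of_telescope` — `oneLoopDrift_betaPT_nat`:
  `Beta.Drift.OneLoopDrift (π⁻²·log L) A (β_·(L))`; also `composedCoeff_betaPT`, `separationRate_betaPT` (defect `C = 0`)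
  and `oneLoopDrift_betaPT_composed` through `oneLoopDrift_of_composedLaw'`; `oneLoopDrift_betaPT` for real `L ≥ 2` directly.

## Why (audit cell `pub-balaban`, β sub-cell; CONTEXT ONLY — nothing below is about Bałaban's coefficients)

RULING (R10) of that cell (BETA-SPEC v1.9n §7.17) organises the one-loop input of [Balaban1987RG1] Theorem 2 through
«B := the FIRST-STEP marginal coefficient at blocking factor n (along n = L^m it is the composed coefficient)», the
telescoping/[H-germ] identity `Σ_{j<k} β⁰_{j+1} = B(L^k)` (resp. `SeparationRate`), and a window law `|B(n) − b log n| ≤ A`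
(`Beta/OneShotTelescope`, `Beta/ComposedRoad`).  This file shows that for the SIBLING 4-d scheme of BBS all three items are
THEOREMS with `A` free of `n` and `L`: (N1) the composed functional is a one-shot object of the blocking product
(`covSum_eq_oneShotCov`), (T1) the telescoping identity (`sum_range_betaPT_eq_firstStep`), (T2) the one-shot window law
(`abs_firstStep_sub_le`), and that the cell's bridge then fires (`oneLoopDrift_betaPT_nat`).  HONEST FRAMING: a sibling
model (vertex bubble, termwise positive); NOTHING about [Balaban1987RG1] (1.22); no transfer statement; discharging that
cell's `BetaPertH` would make Bałaban's UV stability unconditional — NOT the continuum limit, NOT the Clay problem.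
Unit `b2b-balaban-beta-lit2` gen 7 (literature seat LIT2: marginal-flow technology in print).  NOT summit progress.

v1.1 (DOCFIX, docstring-only; every declaration byte-identical to v1 p181617): the JSP/arXiv vs corpus-chunk numbering of
BBS-III Lemma 6.3 (a) recorded (XREAD advisory REFEREE6.md E81 / GAPS C-ref6-81).
-/

noncomputable section

open MeasureTheory Set Filter Topology Finset Real
open Literature.Probability.LatticeModels
open scoped BigOperators

namespace Literature.Barriers.CriticalPhenomena

namespace CTWSAW

open LongRangePhi4 LongRangePhi4.FRD
open Literature.MathematicalPhysics.QuantumFieldTheory.Balaban1983to89.Beta.Drift (OneLoopDrift)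
open Literature.MathematicalPhysics.QuantumFieldTheory.Balaban1983to89.Beta.MarginalTelescoping (composedCoeff
  SeparationRate IdentityForm)
open Literature.MathematicalPhysics.QuantumFieldTheory.Balaban1983to89.Beta.OneShotTelescope (oneLoopDrift_of_telescope
  oneLoopDrift_of_composedLaw' hTel_of_identityForm)

variable {d : ℕ}

/-! ## 1. Integrability of `w(t,x)/t` on bounded scale intervals for every mass `s ≥ 0` -/

/-- `t ↦ w(t,x)/t` is integrable on every bounded interval `(a,b]` with `a ≥ 0`, for every `s ≥ 0` (including the
massless case): it is measurable and bounded there by the uniform constant of `FRD.abs_wKer_div_le`. [folklore] -/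
theorem integrableOn_wKer_div_Ioc_of_nonneg (hd : 1 ≤ d) {s : ℝ} (hs : 0 ≤ s) (x : Site d) {a b : ℝ} (ha : 0 ≤ a) :
    IntegrableOn (fun t : ℝ => wKer d s t x / t) (Ioc a b) := by
  obtain ⟨K, -, hK⟩ := abs_wKer_div_le (d := d) hd
  have hmeas : Measurable fun t : ℝ => wKer d s t x / t :=
    ((measurable_wKer₂ x).comp (measurable_const.prodMk measurable_id)).div measurable_id
  refine Measure.integrableOn_of_bounded (M := K) ?_ hmeas.aestronglyMeasurable ?_
  · rw [Real.volume_Ioc]; exact ENNReal.ofReal_ne_top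
  · refine (ae_restrict_iff' measurableSet_Ioc).2 (ae_of_all _ fun t ht => ?_)
    rw [Real.norm_eq_abs]
    exact hK s hs t (lt_of_le_of_lt ha ht.1) x

/-! ## 2. The one-shot accumulated covariance and bubble -/

/-- **The one-shot accumulated covariance at total blocking factor `N`**: `W_N(x) = ∫_{(0,N/2]} w(t,x) dt/t` — the
`t`-integral of the finite-range construction cut at `t = N/2` (so that `W_{L^k} = Σ_{i≤k} C_i = w_k`,
`covSum_eq_oneShotCov`). [cite: BauerschmidtBrydgesSlade2019RG, Ch. 3, "Finite-range decomposition: lattice" (the integral ∫₀^∞ w(t,x)dt/t decomposed over [0,½L], [½L^{j-1},½L^j])] -/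
def oneShotCov (d : ℕ) (s N : ℝ) (x : Site d) : ℝ := ∫ t in Ioc 0 (N / 2), wKer d s t x / t

/-- **The one-shot bubble** `B(N) = 8 Σ_{x∈ℤ^d} W_N(x)²` at total blocking factor `N`.
[cite: BauerschmidtBrydgesSlade2015LogCorr, Lemma 8.3.1 (proof, first display Σ_{j<k}β_j = 8Σ_x w_k(x)²)] -/
def oneShotBubble (d : ℕ) (s N : ℝ) : ℝ := 8 * ∑' x : Site d, oneShotCov d s N x ^ 2

/-- `C_1 = W_L`: the first slice is the one-shot covariance at blocking factor `L`. [folklore] -/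
theorem Gam_one_eq_oneShotCov (L s : ℝ) (x : Site d) : Gam d L s 1 x = oneShotCov d s L x := by
  unfold Gam oneShotCov scaleLower
  simp

/-- `C_{k+1} = ∫_{(L^k/2, L^{k+1}/2]} w dt/t` for `k ≥ 1`. [folklore] -/
theorem Gam_succ_eq (L s : ℝ) {k : ℕ} (hk : 1 ≤ k) (x : Site d) :
    Gam d L s (k + 1) x = ∫ t in Ioc (L ^ k / 2) (L ^ (k + 1) / 2), wKer d s t x / t := by
  unfold Gam scaleLower
  rw [if_neg (by omega), Nat.add_sub_cancel]

/-- Additivity of the one-shot covariance across one more slice: `W_{L^{k+1}} = W_{L^k} + C_{k+1}` (`k ≥ 1`, `L ≥ 1`,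
`s ≥ 0`). [folklore] -/
theorem oneShotCov_pow_succ (hd : 1 ≤ d) {L : ℝ} (hL : 1 ≤ L) {s : ℝ} (hs : 0 ≤ s) {k : ℕ} (hk : 1 ≤ k)
    (x : Site d) :
    oneShotCov d s (L ^ (k + 1)) x = oneShotCov d s (L ^ k) x + Gam d L s (k + 1) x := by
  rw [Gam_succ_eq L s hk x]
  unfold oneShotCov
  have h0 : (0 : ℝ) ≤ L ^ k / 2 := by positivity
  have h1 : L ^ k / 2 ≤ L ^ (k + 1) / 2 := by
    have : L ^ k ≤ L ^ (k + 1) := pow_le_pow_right₀ hL (Nat.le_succ k)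
    linarith
  rw [← Ioc_union_Ioc_eq_Ioc h0 h1]
  exact setIntegral_union (Ioc_disjoint_Ioc.2 (by simp)) measurableSet_Ioc
    (integrableOn_wKer_div_Ioc_of_nonneg hd hs x le_rfl) (integrableOn_wKer_div_Ioc_of_nonneg hd hs x h0)

/-- **(N1) for BBS: `w_k = W_{L^k}`** — the accumulated covariance after `k ≥ 1` steps of ratio `L` is the one-shot
covariance at the total blocking factor `L^k`; it depends on `L` and `k` only through `L^k` (`L ≥ 1`, `s ≥ 0`).
[cite: BauerschmidtBrydgesSlade2019RG, Ch. 3, "Finite-range decomposition: lattice"] -/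
theorem covSum_eq_oneShotCov (hd : 1 ≤ d) {L : ℝ} (hL : 1 ≤ L) {s : ℝ} (hs : 0 ≤ s) {k : ℕ} (hk : 1 ≤ k)
    (x : Site d) : covSum d L s k x = oneShotCov d s (L ^ k) x := by
  induction k with
  | zero => exact absurd hk (by omega)
  | succ k ih =>
    rcases Nat.eq_zero_or_pos k with hk0 | hk0
    · subst hk0
      simp [covSum_succ, Gam_one_eq_oneShotCov]
    · rw [covSum_succ, ih hk0, oneShotCov_pow_succ hd hL hs hk0 x]

/-- **(T1) for BBS, one-shot form: `Σ_{j<k} β_j(L) = B(L^k)`** for `k ≥ 1` (`L ≥ 1`, `s ≥ 0`, `d ≥ 1`).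
[cite: BauerschmidtBrydgesSlade2015LogCorr, Lemma 8.3.1 (proof, first display)] -/
theorem sum_range_betaPT_eq_oneShotBubble (hd : 1 ≤ d) {L : ℝ} (hL : 1 ≤ L) {s : ℝ} (hs : 0 ≤ s) {k : ℕ}
    (hk : 1 ≤ k) : ∑ j ∈ Finset.range k, betaPT d L s j = oneShotBubble d s (L ^ k) := by
  rw [sum_range_betaPT_eq_tsum hd hL hs k]
  unfold oneShotBubble
  congr 1
  exact tsum_congr fun x => by rw [covSum_eq_oneShotCov hd hL hs hk x]

/-- `β_0(L) = B(L)`: the first coefficient IS the one-shot bubble at blocking factor `L`. [folklore] -/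
theorem betaPT_zero_eq_oneShotBubble (hd : 1 ≤ d) {L : ℝ} (hL : 1 ≤ L) {s : ℝ} (hs : 0 ≤ s) :
    betaPT d L s 0 = oneShotBubble d s L := by
  have h := sum_range_betaPT_eq_oneShotBubble hd hL hs (le_refl 1)
  simpa using h

/-- **`β_j(L) = B(L^{j+1}) − B(L^j)`** for `j ≥ 1`: every later coefficient is an INCREMENT of the one-shot bubble along
the powers of `L`. [folklore] -/
theorem betaPT_eq_oneShotBubble_sub (hd : 1 ≤ d) {L : ℝ} (hL : 1 ≤ L) {s : ℝ} (hs : 0 ≤ s) {j : ℕ} (hj : 1 ≤ j) :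
    betaPT d L s j = oneShotBubble d s (L ^ (j + 1)) - oneShotBubble d s (L ^ j) := by
  have h1 := sum_range_betaPT_eq_oneShotBubble hd hL hs (show 1 ≤ j + 1 by omega)
  have h0 := sum_range_betaPT_eq_oneShotBubble hd hL hs hj
  rw [Finset.sum_range_succ, h0] at h1
  linarith

/-- `β_1(L) = B(L²) − B(L)` — the sibling-model form of the audit cell's «(T1) prediction β⁰₂(L) = B(L²) − B(L)»
(BETA-SPEC §7.17 (R10-4), num row); here an identity. [folklore] -/
theorem betaPT_one_eq (hd : 1 ≤ d) {L : ℝ} (hL : 1 ≤ L) {s : ℝ} (hs : 0 ≤ s) :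
    betaPT d L s 1 = oneShotBubble d s (L ^ 2) - oneShotBubble d s L := by
  have h := betaPT_eq_oneShotBubble_sub hd hL hs (le_refl 1)
  rwa [pow_one] at h

/-! ## 3. Composition of blocking factors: `k` steps at ratio `L^m` = `mk` steps at ratio `L` -/

/-- **`w_k(L^m) = w_{mk}(L)`**: the accumulated covariance after `k` steps of ratio `L^m` equals the one after `mk`
steps of ratio `L` (`L ≥ 1`, `s ≥ 0`; both are `W_{L^{mk}}`) — the finite-range-decomposition form of «Computing `λ_n` to
the second order in `λ₀` is equivalent to computing `λ₁` to `O(λ₀²)` for `L → L^n`» (Gawędzki–Kupiainen, CMP 99 (1985)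
p. 208 l. 1–2, for their block-spin scheme). [folklore] -/
theorem covSum_pow_eq (hd : 1 ≤ d) {L : ℝ} (hL : 1 ≤ L) {s : ℝ} (hs : 0 ≤ s) {m k : ℕ} (hm : 1 ≤ m) (hk : 1 ≤ k)
    (x : Site d) : covSum d (L ^ m) s k x = covSum d L s (m * k) x := by
  have hLm : (1 : ℝ) ≤ L ^ m := one_le_pow₀ hL
  rw [covSum_eq_oneShotCov hd hLm hs hk x, covSum_eq_oneShotCov hd hL hs (Nat.one_le_iff_ne_zero.2
    (Nat.mul_ne_zero (by omega) (by omega))) x, ← pow_mul]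

/-- **`Σ_{j<k} β_j(L^m) = Σ_{j<mk} β_j(L)`** for all `k` (`m ≥ 1`, `L ≥ 1`, `s ≥ 0`): the perturbative partial sums of the
ratio-`L^m` scheme are those of the ratio-`L` scheme read at every `m`-th scale. [folklore] -/
theorem sum_range_betaPT_pow (hd : 1 ≤ d) {L : ℝ} (hL : 1 ≤ L) {s : ℝ} (hs : 0 ≤ s) {m : ℕ} (hm : 1 ≤ m) (k : ℕ) :
    ∑ j ∈ Finset.range k, betaPT d (L ^ m) s j = ∑ j ∈ Finset.range (m * k), betaPT d L s j := by
  rcases Nat.eq_zero_or_pos k with hk | hk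
  · subst hk; simp
  · have hLm : (1 : ℝ) ≤ L ^ m := one_le_pow₀ hL
    rw [sum_range_betaPT_eq_oneShotBubble hd hLm hs hk, sum_range_betaPT_eq_oneShotBubble hd hL hs
      (Nat.one_le_iff_ne_zero.2 (Nat.mul_ne_zero (by omega) (by omega))), ← pow_mul]

/-- **`β_0(L^m) = Σ_{j<m} β_j(L)`**: ONE step at ratio `L^m` has, at second order, exactly the coefficient accumulated by
`m` steps at ratio `L` (`m ≥ 1`, `L ≥ 1`, `s ≥ 0`). [folklore] -/
theorem betaPT_zero_pow_eq_sum_range (hd : 1 ≤ d) {L : ℝ} (hL : 1 ≤ L) {s : ℝ} (hs : 0 ≤ s) {m : ℕ} (hm : 1 ≤ m) :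
    betaPT d (L ^ m) s 0 = ∑ j ∈ Finset.range m, betaPT d L s j := by
  have h := sum_range_betaPT_pow hd hL hs hm 1
  simpa using h

/-! ## 4. The one-shot window law (`d = 4`, `m² = 0`) -/

/-- **ONE-SHOT WINDOW LAW: `|B(N) − (log N)/π²| ≤ A` for every real `N ≥ 2`**, `A` free of `N` — the `k = 1` case of
`abs_sum_range_betaPT_zero_sub_le` read through `betaPT_zero_eq_oneShotBubble`.
[cite: BauerschmidtBrydgesSlade2015RGIII, Lemma 6.3 (a) (d = 4)] -/
theorem abs_oneShotBubble_sub_log_le : ∃ A : ℝ, 0 ≤ A ∧ ∀ N : ℝ, 2 ≤ N →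
    |oneShotBubble 4 0 N - Real.log N / π ^ 2| ≤ A := by
  obtain ⟨A, hA, h⟩ := abs_sum_range_betaPT_zero_sub_le
  refine ⟨A, hA, fun N hN => ?_⟩
  have h1 := h N hN 1
  rw [← betaPT_zero_eq_oneShotBubble (by norm_num) (by linarith) le_rfl]
  simpa using h1

/-- Conversely, the `k`-step partial-sum law is the one-shot law at `N = L^k`: `|B(L^k) − k(log L)/π²| ≤ A` for all real
`L ≥ 2`, `k ≥ 1`, with the SAME `A` (`log L^k = k log L`). [folklore] -/
theorem abs_oneShotBubble_pow_sub_le : ∃ A : ℝ, 0 ≤ A ∧ ∀ L : ℝ, 2 ≤ L → ∀ k : ℕ, 1 ≤ k →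
    |oneShotBubble 4 0 (L ^ k) - k * Real.log L / π ^ 2| ≤ A := by
  obtain ⟨A, hA, h⟩ := abs_oneShotBubble_sub_log_le
  refine ⟨A, hA, fun L hL k hk => ?_⟩
  have hLk : (2 : ℝ) ≤ L ^ k :=
    calc (2 : ℝ) = 2 ^ 1 := by norm_num
      _ ≤ 2 ^ k := pow_le_pow_right₀ (by norm_num) hk
      _ ≤ L ^ k := pow_le_pow_left₀ (by norm_num) hL k
  have h1 := h (L ^ k) hLk
  rwa [Real.log_pow] at h1

/-- **The audit cell's END carrier, inhabited (real `L`)**: `OneLoopDrift ((log L)/π²) A (j ↦ β_j(L))` for every real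
`L ≥ 2`, `A` free of `L` — the partial sums drift linearly with slope `(log L)/π²`. [folklore] -/
theorem oneLoopDrift_betaPT : ∃ A : ℝ, 0 ≤ A ∧ ∀ L : ℝ, 2 ≤ L →
    OneLoopDrift (Real.log L / π ^ 2) A (fun j => betaPT 4 L 0 j) := by
  obtain ⟨A, hA, h⟩ := abs_sum_range_betaPT_zero_sub_le
  refine ⟨A, hA, fun L hL k => ?_⟩
  have h1 := h L hL k
  rwa [show (k : ℝ) * Real.log L / π ^ 2 = Real.log L / π ^ 2 * k by ring] at h1

/-! ## 5. The ℕ-indexed first-step family and the audit cell's bridges -/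

/-- **The first-step family** on natural blocking factors: `firstStep n = B(n)` for `n ≥ 2` and `0` for `n < 2`
(no step at blocking factor `1`), `d = 4`, `m² = 0`. [folklore] -/
def firstStep (n : ℕ) : ℝ := if n < 2 then 0 else oneShotBubble 4 0 n

/-- `firstStep n = B(n)` for `n ≥ 2`. [folklore] -/
theorem firstStep_of_two_le {n : ℕ} (hn : 2 ≤ n) : firstStep n = oneShotBubble 4 0 n := by
  unfold firstStep
  rw [if_neg (by omega)]

/-- **(T1) for BBS in the cell's shape: `Σ_{j<k} β_j(L) = firstStep (L^k)` for ALL `k`** (natural `L ≥ 2`; at `k = 0`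
both sides vanish). [cite: BauerschmidtBrydgesSlade2015LogCorr, Lemma 8.3.1 (proof, first display)] -/
theorem sum_range_betaPT_eq_firstStep {L : ℕ} (hL : 2 ≤ L) (k : ℕ) :
    ∑ j ∈ Finset.range k, betaPT 4 (L : ℝ) 0 j = firstStep (L ^ k) := by
  rcases Nat.eq_zero_or_pos k with hk | hk
  · subst hk
    simp [firstStep]
  · have hLk : 2 ≤ L ^ k :=
      calc 2 ≤ L ^ 1 := by simpa using hL
        _ ≤ L ^ k := Nat.pow_le_pow_right (by omega) hk
    rw [firstStep_of_two_le hLk, sum_range_betaPT_eq_oneShotBubble (by norm_num) (by exact_mod_cast (by omega : 1 ≤ L))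
      le_rfl hk, Nat.cast_pow]

/-- **(T2) for BBS in the cell's shape: `|firstStep n − π⁻²·log n| ≤ A` for every natural `n ≥ 2`**, `A` free of `n`.
[cite: BauerschmidtBrydgesSlade2015RGIII, Lemma 6.3 (a) (d = 4)] -/
theorem abs_firstStep_sub_le : ∃ A : ℝ, 0 ≤ A ∧ ∀ n : ℕ, 2 ≤ n →
    |firstStep n - 1 / π ^ 2 * Real.log n| ≤ A := by
  obtain ⟨A, hA, h⟩ := abs_oneShotBubble_sub_log_le
  refine ⟨A, hA, fun n hn => ?_⟩
  rw [firstStep_of_two_le hn, show 1 / π ^ 2 * Real.log n = Real.log n / π ^ 2 by ring]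
  exact h n (by exact_mod_cast hn)

/-- **THE CELL'S ONE-SHOT BRIDGE FIRES ON BBS**: through `Beta.OneShotTelescope.oneLoopDrift_of_telescope` (hypotheses:
the telescoping identity and the first-step window law), `OneLoopDrift (π⁻²·log L) A (j ↦ β_j(L))` for every natural
`L ≥ 2`, with the `A` of `abs_firstStep_sub_le` (free of `L`). [folklore] -/
theorem oneLoopDrift_betaPT_nat : ∃ A : ℝ, 0 ≤ A ∧ ∀ L : ℕ, 2 ≤ L →
    OneLoopDrift (1 / π ^ 2 * Real.log L) A (fun j => betaPT 4 (L : ℝ) 0 j) := by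
  obtain ⟨A, hA, h⟩ := abs_firstStep_sub_le
  exact ⟨A, hA, fun L hL => oneLoopDrift_of_telescope hL hA (sum_range_betaPT_eq_firstStep hL) h⟩

/-- The old-term contributions of the BBS composed bubble: term `j` contributes `8Σ_x(w_{j+1}² − w_j²) = β_j(L)` at EVERY
later step (the composed functional after `k` steps is `8Σ_x w_k²`, telescoped) — so `IdentityForm` holds by definition.
[folklore] -/
theorem identityForm_betaPT (L : ℝ) : IdentityForm (fun j _ => betaPT 4 L 0 j) (fun j => betaPT 4 L 0 j) :=
  fun _ _ _ => rfl

/-- … hence `SeparationRate 0 θ` (zero defect) for any `θ`. [folklore] -/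
theorem separationRate_betaPT (L θ : ℝ) : SeparationRate 0 θ (fun j _ => betaPT 4 L 0 j) (fun j => betaPT 4 L 0 j) := by
  intro j k _
  simp

/-- The composed coefficient of the cell's bookkeeping IS the first-step family along the powers:
`composedCoeff μ m = firstStep (L^m)` for all `m` (natural `L ≥ 2`). [folklore] -/
theorem composedCoeff_betaPT {L : ℕ} (hL : 2 ≤ L) (m : ℕ) :
    composedCoeff (fun j _ => betaPT 4 (L : ℝ) 0 j) m = firstStep (L ^ m) := by
  unfold composedCoeff
  exact sum_range_betaPT_eq_firstStep hL m

/-- **THE CELL'S COMPOSED-ROAD BRIDGE FIRES ON BBS**: through `Beta.OneShotTelescope.oneLoopDrift_of_composedLaw'`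
(hypotheses: `SeparationRate C θ`, `composedCoeff = firstStep ∘ (L^·)`, the first-step window law) with `C = 0`,
`θ = 1/2`: `OneLoopDrift (π⁻²·log L) (A + 0) (j ↦ β_j(L))`. [folklore] -/
theorem oneLoopDrift_betaPT_composed : ∃ A : ℝ, 0 ≤ A ∧ ∀ L : ℕ, 2 ≤ L →
    OneLoopDrift (1 / π ^ 2 * Real.log L) (A + 0 * (1 / 2) / (1 - 1 / 2)) (fun j => betaPT 4 (L : ℝ) 0 j) := by
  obtain ⟨A, hA, h⟩ := abs_firstStep_sub_le
  exact ⟨A, hA, fun L hL => oneLoopDrift_of_composedLaw' hL hA le_rfl (by norm_num) (by norm_num)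
    (separationRate_betaPT (L : ℝ) (1 / 2)) (composedCoeff_betaPT hL) h⟩

end CTWSAW

end Literature.Barriers.CriticalPhenomena

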